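import Summits.ResolutionOfSingularities.ResolutionOfSingularities.Theorems.PurelyInseparableDim4ChartAtlasSNCObstruction
import Summits.ResolutionOfSingularities.ResolutionOfSingularities.Theorems.PurelyInseparableDim4ChartAtlasShearedMember
import Summits.ResolutionOfSingularities.ResolutionOfSingularities.Theorems.PurelyInseparableDim4ChartCentreClosed
import HarnessLib

/-!
# Purely inseparable four-folds `z^p + F(x₁, …, x₄)`: FAR RESONANCE — a third bad class of the S3-N2 dichotomy, off the exceptional
# divisor (cell `res-dim4-pi`, typ-2 g5)

[OURS · counted 0] (D-0157 DOOR 2; DR-157-C; desk WORD #115 (a)/(c), #131 (c)). The S3-N2 bad set `B` (p690374) collects the old members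
THROUGH the blown-up centre `V(z, x_S)` whose strict transforms cross the escaping global centre `Zc` badly along `E₁`. This file
records that FAR old members — `{xᵢ = -cᵢ}`, `cᵢ ≠ 0`, disjoint from `V(z, x_S)` — can obstruct too, OFF `E₁`: on the `x_j`-chart
(re-centred at `b`, `b_j = 0`, coordinates `y`), for the ESCAPING case `j ∉ S'`,
* the far member `{x_j = -c'}` reads the translated hyperplane `(y_j + c')·𝒪` (`comap_recenter_chart_strictTransform_far_self`);
* a far member `{xᵢ = -cᵢ}`, `i ∈ S ∖ {j}`, reads the QUADRIC `((yᵢ + bᵢ)·y_j + cᵢ)·𝒪` (`comap_recenter_chart_strictTransform_far`);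
* both meet `Zc = V(y_0, y_{S'})` at the height `y_j = -c'` when `i ∈ S'`, `bᵢ ≠ 0` and **`cᵢ = bᵢ·c'` (RESONANCE)**, and there their
  conormal vectors agree modulo the conormal space of `Zc` — so `Zc` is NOT snc with the boundary:
  `not_hasSNCWith_of_hyperplane_and_quadric` (model, after the translation `y_j ↦ y_j - c'`), `not_hasSNCWith_of_far_resonance`
  (model, actual readings), `not_hasSNCWith_of_far_resonance_chart_readings` (any `W` carrying such readings) and
  **`not_hasSNCWith_globalCentre_of_far_resonance`** (the blown-up `W` itself, `Zc` = closure of `φⱼ(V(z, x_{S'}))`).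
The proof is p690374's minimality argument at the generic point of `V(y_0, y_{S'}, y_j)`: the quadric's germ lies in `(y_j) + (yᵢ)`.
So «`|B| ≤ 1`» (near members) is NOT sufficient for admissibility once far members are carried: the census predicate needs the heights
`-c'` (of a far `{x_j = -c'}`) and `-cᵢ/bᵢ` (of far `{xᵢ = -cᵢ}`, `i ∈ S ∩ S'`, `bᵢ ≠ 0`); two equal non-zero heights obstruct (over `𝔽₂`:
any two such members). Nothing here is a statement about resolution of singularities in dimension ≥ 4 / characteristic `p` (NOT proved
anywhere in this programme). bears_on: LADDER-RESOLUTION:D157-DOOR2 (res-dim4-pi). Supports stmt-ResolutionOfSingularities-16155 (helper).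
-/

-- every declaration of this summit lives under `Summit.ResolutionOfSingularities.ResolutionOfSingularities`
-- (summit = problem), which the duplicate-namespace linter flags; house convention (cf. the Target file).
set_option linter.dupNamespace false

noncomputable section

open MvPolynomial Finset CategoryTheory AlgebraicGeometry Opposite TopologicalSpace IsLocalRing
open AlgebraicGeometry.Scheme.IdealSheafData (ofIdealTop vanishingIdeal)

namespace Summit.ResolutionOfSingularities.ResolutionOfSingularities.Theorems.PIDim4

open Literature.AlgebraicGeometry.Resolution
open Literature.AlgebraicGeometry.Resolution.AffinePointBlowup (P A γ coord Wtop ξ)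
open Literature.AlgebraicGeometry.Hironaka2017.SpecOrders
open Literature.RingTheory.MvPolynomial (X_mem_span_X_image_iff)

namespace ChartDictionary

variable {K : Type} [Field K] {S S' T : Finset (Fin 4)} {i j : Fin 4} {b c' : K} {W : Scheme.{0}} {π : W ⟶ P 4 K}

/-! ## §1 The obstruction on the model, translated frame (`{y_j = 0}` and the quadric `((yᵢ + b) y_j - c' yᵢ)`) -/

/-- The quadric `(yᵢ + b)·y_j - c'·yᵢ` (`c' ≠ 0`) is not a multiple of `y_j`. -/
theorem quadric_not_mem_span_X (hij : i ≠ j) (b : K) (hc' : c' ≠ 0) :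
    ((X i.succ + C b) * X j.succ - C c' * X i.succ : A 4 K) ∉ Ideal.span (X '' ({j.succ} : Set (Fin (4 + 1)))) := by
  classical
  intro hmem
  rw [mem_ideal_span_X_image] at hmem
  have hsupp : Finsupp.single i.succ 1 ∈ ((X i.succ + C b) * X j.succ - C c' * X i.succ : A 4 K).support := by
    rw [MvPolynomial.mem_support_iff, coeff_sub, coeff_C_mul, coeff_X, if_pos rfl, mul_one, mul_comm, coeff_X_mul',
      if_neg, zero_sub, neg_ne_zero]
    · exact hc'
    · rw [Finsupp.mem_support_iff, not_not]
      exact Finsupp.single_eq_of_ne (fun e => hij (Fin.succ_inj.mp e).symm)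
  obtain ⟨k, hk, hne⟩ := hmem _ hsupp
  rw [Set.mem_singleton_iff] at hk
  subst hk
  exact hne (Finsupp.single_eq_of_ne (fun e => hij (Fin.succ_inj.mp e).symm))

/-- The ideal sheaves `y_j·𝒪` and `((yᵢ + b) y_j - c' yᵢ)·𝒪` are different (`i ≠ j`, `c' ≠ 0`). -/
theorem ofIdealTop_X_ne_ofIdealTop_quadric (hij : i ≠ j) (b : K) (hc' : c' ≠ 0) :
    ofIdealTop (Ideal.span {(γ 4 K).symm (X j.succ)}) ≠
      ofIdealTop (Ideal.span {(γ 4 K).symm ((X i.succ + C b) * X j.succ - C c' * X i.succ)}) := by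
  intro e
  let Q : P 4 K := ⟨AffineCoordBlowup.IΛ 4 K ({j.succ} : Set (Fin (4 + 1))), AffineCoordBlowup.isPrime_IΛ 4 K _⟩
  have h1 : Q ∈ (ofIdealTop (Ideal.span {(γ 4 K).symm (X j.succ)})).support := by
    rw [ofIdealTop_span_γ_symm_eq_shf, mem_support_shf_iff, Ideal.span_singleton_le_iff_mem]
    exact Ideal.subset_span ⟨j.succ, Set.mem_singleton _, rfl⟩
  rw [e, ofIdealTop_span_γ_symm_eq_shf, mem_support_shf_iff, Ideal.span_singleton_le_iff_mem] at h1
  exact quadric_not_mem_span_X hij b hc' h1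

/-- **FAR RESONANCE ON THE MODEL (translated frame).** `i ∈ T`, `j ∉ T`, `b ≠ 0`, `c' ≠ 0`; any list `E` on `𝔸⁵` containing
`y_j·𝒪` and the quadric `((yᵢ + b)·y_j - c'·yᵢ)·𝒪` does NOT have snc with `𝓘Λ_T`: at the generic point of `V(y_0, y_T, y_j)` the
quadric's germ lies in `(y_j) + (yᵢ) ⊆ (u_a) + 𝓘Λ_T`, contradicting the minimality of the adapted regular system. -/
theorem not_hasSNCWith_of_hyperplane_and_quadric (hiT : i ∈ T) (hjT : j ∉ T) (hb : b ≠ 0) (hc' : c' ≠ 0)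
    {E : List (P 4 K).IdealSheafData} (hDj : ofIdealTop (Ideal.span {(γ 4 K).symm (X j.succ)}) ∈ E)
    (hDq : ofIdealTop (Ideal.span {(γ 4 K).symm ((X i.succ + C b) * X j.succ - C c' * X i.succ)}) ∈ E) :
    ¬ HasSNCWith E (AffineCoordBlowup.𝓘Λ 4 K (insert 0 (Fin.succ '' (T : Set (Fin 4))))) := by
  classical
  intro h
  have hij : i ≠ j := fun e => hjT (e ▸ hiT)
  set Λ : Set (Fin (4 + 1)) := insert 0 (Fin.succ '' (T : Set (Fin 4))) with hΛ
  set q : A 4 K := (X i.succ + C b) * X j.succ - C c' * X i.succ with hq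
  set Dj := ofIdealTop (Ideal.span {(γ 4 K).symm (X j.succ)}) with hDjdef
  set Dq := ofIdealTop (Ideal.span {(γ 4 K).symm q}) with hDqdef
  have hDj' : Dj = shf (A 4 K) (Ideal.span {(X j.succ : A 4 K)}) := ofIdealTop_span_γ_symm_eq_shf _
  have hDq' : Dq = shf (A 4 K) (Ideal.span {q}) := ofIdealTop_span_γ_symm_eq_shf _
  have hC' : AffineCoordBlowup.𝓘Λ 4 K Λ = shf (A 4 K) (AffineCoordBlowup.IΛ 4 K Λ) :=
    Cruxes.EquisingularLiftNat.Sections.ND.𝓘Λ_eq_idealSheafOf 4 K Λ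
  -- the generic point of `V(y_0, y_T, y_j)`
  let Pt : P 4 K := ⟨AffineCoordBlowup.IΛ 4 K (insert 0 (Fin.succ '' ((insert j T : Finset (Fin 4)) : Set (Fin 4)))),
    AffineCoordBlowup.isPrime_IΛ 4 K _⟩
  have hle : AffineCoordBlowup.IΛ 4 K Λ ≤ Pt.asIdeal := by
    refine Ideal.span_mono (Set.image_mono (Set.insert_subset_insert (Set.image_mono ?_)))
    rw [Finset.coe_insert]
    exact Set.subset_insert _ _
  have hXj : (X j.succ : A 4 K) ∈ Pt.asIdeal :=
    Ideal.subset_span ⟨j.succ, Set.mem_insert_of_mem _ ⟨j, by rw [Finset.coe_insert]; exact Set.mem_insert _ _, rfl⟩, rfl⟩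
  have hXi : (X i.succ : A 4 K) ∈ AffineCoordBlowup.IΛ 4 K Λ :=
    Ideal.subset_span ⟨i.succ, Set.mem_insert_of_mem _ ⟨i, Finset.mem_coe.mpr hiT, rfl⟩, rfl⟩
  have hqmem : q ∈ Ideal.span {(X j.succ : A 4 K)} ⊔ Ideal.span {(X i.succ : A 4 K)} := by
    rw [hq]
    exact Ideal.sub_mem _ (Ideal.mem_sup_left (Ideal.mul_mem_left _ _ (Ideal.mem_span_singleton_self _)))
      (Ideal.mem_sup_right (Ideal.mul_mem_left _ _ (Ideal.mem_span_singleton_self _)))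
  have hPC : Pt ∈ (AffineCoordBlowup.𝓘Λ 4 K Λ).support := by
    rw [hC', mem_support_shf_iff]; exact hle
  have hPDj : Pt ∈ Dj.support := by
    rw [hDj', mem_support_shf_iff, Ideal.span_singleton_le_iff_mem]; exact hXj
  have hPDq : Pt ∈ Dq.support := by
    rw [hDq', mem_support_shf_iff, Ideal.span_singleton_le_iff_mem, hq]
    exact Ideal.sub_mem _ (Ideal.mul_mem_left _ _ hXj) (Ideal.mul_mem_left _ _ (hle hXi))
  -- the unit `yᵢ + b` at that point
  haveI : Pt.asIdeal.IsPrime := Pt.2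
  haveI : IsLocalization.AtPrime (St (A 4 K) Pt) Pt.asIdeal :=
    Literature.AlgebraicGeometry.Hironaka2017.SpecOrders.isLocSt (A 4 K) Pt
  have hunit : IsUnit (algebraMap (A 4 K) (St (A 4 K) Pt) (X i.succ + C b)) := by
    refine IsLocalization.map_units (St (A 4 K) Pt) (⟨X i.succ + C b, ?_⟩ : Pt.asIdeal.primeCompl)
    intro hmem
    have hXi' : (X i.succ : A 4 K) ∈ Pt.asIdeal := hle hXi
    have hCb : (C b : A 4 K) ∈ Pt.asIdeal := by
      have h2 := Pt.asIdeal.sub_mem hmem hXi'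
      rwa [add_sub_cancel_left] at h2
    exact Pt.2.ne_top ((Ideal.eq_top_iff_one _).mpr (by
      have h3 := Pt.asIdeal.mul_mem_left (C b⁻¹) hCb
      rwa [← C_mul, inv_mul_cancel₀ hb, C_1] at h3))
  -- the snc data at that point
  obtain ⟨hreg, u, hu, ⟨ι, hιinj, hι⟩, hC⟩ := h Pt
  haveI := hreg
  obtain ⟨Sset, hS⟩ := hC hPC
  set φ := algebraMap (A 4 K) (St (A 4 K) Pt) with hφ
  set a := ι ⟨Dj, hDj, hPDj⟩ with ha
  set c := ι ⟨Dq, hDq, hPDq⟩ with hc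
  have hac : a ≠ c := fun e => by
    have h1 := congrArg Subtype.val (hιinj e)
    exact ofIdealTop_X_ne_ofIdealTop_quadric (K := K) hij b hc' h1
  have h1 : Ideal.span {φ (X j.succ)} = Ideal.span {u a} := by
    rw [ha, ← hι ⟨Dj, hDj, hPDj⟩]
    change _ = stalkIdeal Dj Pt
    rw [hDj', stalkIdeal_shf, Ideal.map_span, Set.image_singleton]
  have h2 : Ideal.span {φ q} = Ideal.span {u c} := by
    rw [hc, ← hι ⟨Dq, hDq, hPDq⟩]
    change _ = stalkIdeal Dq Pt
    rw [hDq', stalkIdeal_shf, Ideal.map_span, Set.image_singleton]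
  have h3 : (AffineCoordBlowup.IΛ 4 K Λ).map φ = Ideal.span (u '' Sset) := by
    rw [← hS, hC', stalkIdeal_shf]
  have hxi : φ (X i.succ) ∈ (AffineCoordBlowup.IΛ 4 K Λ).map φ := Ideal.mem_map_of_mem _ hXi
  -- Step 1: `c ∉ Sset` — otherwise `(yᵢ + b) y_j ∈ (y_0, y_T)·𝒪_𝔭`, so `y_j ∈ (y_0, y_T)`
  have hcS : c ∉ Sset := by
    intro hcS
    have huc : u c ∈ (AffineCoordBlowup.IΛ 4 K Λ).map φ := by
      rw [h3]; exact Ideal.subset_span ⟨c, hcS, rfl⟩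
    have hgen : φ q ∈ (AffineCoordBlowup.IΛ 4 K Λ).map φ := by
      have h4 : φ q ∈ Ideal.span {u c} := by rw [← h2]; exact Ideal.mem_span_singleton_self _
      obtain ⟨w, hw⟩ := Ideal.mem_span_singleton'.mp h4
      rw [← hw]
      exact Ideal.mul_mem_left _ _ huc
    have hprod : φ ((X i.succ + C b) * X j.succ) ∈ (AffineCoordBlowup.IΛ 4 K Λ).map φ := by
      have h4 := Ideal.add_mem _ hgen (Ideal.mul_mem_left _ (φ (C c')) hxi)
      rwa [hq, map_sub, map_mul φ (C c'), sub_add_cancel] at h4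
    have hxj : φ (X j.succ) ∈ (AffineCoordBlowup.IΛ 4 K Λ).map φ := by
      obtain ⟨v, hv⟩ := hunit
      rw [map_mul, ← hv] at hprod
      have h5 := Ideal.mul_mem_left _ (↑v⁻¹ : St (A 4 K) Pt) hprod
      rwa [← mul_assoc, Units.inv_mul, one_mul] at h5
    exact X_succ_not_mem_IΛ hjT (mem_IΛ_of_algebraMap_mem_map Pt hle hxj)
  -- Step 2: `u_c ∈ (u_k : k ∈ insert a Sset)` — contradicting minimality of the basis `u` of `𝔪`
  have hca : c ∉ insert a Sset := by
    rintro (e | e)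
    · exact hac e.symm
    · exact hcS e
  refine not_mem_span_image_of_not_mem rfl u hu hca ?_
  have h4 : u c ∈ Ideal.span {φ q} := by rw [h2]; exact Ideal.mem_span_singleton_self _
  obtain ⟨w, hw⟩ := Ideal.mem_span_singleton'.mp h4
  rw [← hw]
  refine Ideal.mul_mem_left _ _ ?_
  have hsub : Ideal.span (u '' Sset) ≤ Ideal.span (u '' insert a Sset) := Ideal.span_mono (Set.image_mono (Set.subset_insert _ _))
  have h5 : φ (X j.succ) ∈ Ideal.span (u '' insert a Sset) := by
    have h6 : φ (X j.succ) ∈ Ideal.span {u a} := by rw [← h1]; exact Ideal.mem_span_singleton_self _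
    exact (Ideal.span_mono (Set.singleton_subset_iff.mpr (Set.mem_image_of_mem u (Set.mem_insert a Sset)))) h6
  rw [hq, map_sub, map_mul, map_mul]
  exact Ideal.sub_mem _ (Ideal.mul_mem_left _ _ h5) (Ideal.mul_mem_left _ _ (hsub (h3 ▸ hxi)))

/-! ## §2 The actual readings: `(y_j + c')·𝒪` and `((yᵢ + b) y_j + b c')·𝒪` -/

/-- **FAR RESONANCE ON THE MODEL.** `i ∈ T`, `j ∉ T`, `b ≠ 0`, `c' ≠ 0`; any list on `𝔸⁵` containing the far hyperplane
`(y_j + c')·𝒪` and the far quadric `((yᵢ + b)·y_j + b·c')·𝒪` (both through the height `y_j = -c'` of `V(y_0, y_T)`) does NOT have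
snc with `𝓘Λ_T`. (Translate `y_j ↦ y_j - c'` and use §1.) -/
theorem not_hasSNCWith_of_far_resonance (hiT : i ∈ T) (hjT : j ∉ T) (hb : b ≠ 0) (hc' : c' ≠ 0)
    {E : List (P 4 K).IdealSheafData} (hDj : ofIdealTop (Ideal.span {(γ 4 K).symm (X j.succ + C c')}) ∈ E)
    (hDq : ofIdealTop (Ideal.span {(γ 4 K).symm ((X i.succ + C b) * X j.succ + C (b * c'))}) ∈ E) :
    ¬ HasSNCWith E (AffineCoordBlowup.𝓘Λ 4 K (insert 0 (Fin.succ '' (T : Set (Fin 4))))) := by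
  classical
  intro h
  have hij : i ≠ j := fun e => hjT (e ▸ hiT)
  set cv : Fin (4 + 1) → K := Function.update 0 j.succ (-c') with hcv
  have hcvΛ : ∀ k ∈ insert (0 : Fin (4 + 1)) (Fin.succ '' (T : Set (Fin 4))), cv k = 0 := by
    rintro k (rfl | ⟨t, ht, rfl⟩)
    · rw [hcv, Function.update_of_ne (Fin.succ_ne_zero j).symm]; rfl
    · rw [hcv, Function.update_of_ne (fun e => hjT (by rw [← Fin.succ_inj.mp e]; exact Finset.mem_coe.mp ht))]; rfl
  have hcvj : cv j.succ = -c' := by rw [hcv, Function.update_self]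
  have hcvi : cv i.succ = 0 := by rw [hcv, Function.update_of_ne (fun e => hij (Fin.succ_inj.mp e))]; rfl
  let σ := AffinePointBlowup.translateEquiv (K := K) (n := 4) cv
  haveI : IsIso (CommRingCat.ofHom (σ : A 4 K →+* A 4 K)) := (inferInstance : IsIso σ.toRingEquiv.toCommRingCatIso.hom)
  have h' := h.comap_of_isOpenImmersion (Spec.map (CommRingCat.ofHom (σ : A 4 K →+* A 4 K)))
  rw [comap_translate_𝓘Λ cv _ hcvΛ] at h'
  have hσC : ∀ r : K, σ (C r) = C r := fun r => σ.commutes r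
  have hσX : ∀ k : Fin (4 + 1), σ (X k) = X k + C (cv k) := fun k => AffinePointBlowup.translateEquiv_X cv k
  refine not_hasSNCWith_of_hyperplane_and_quadric hiT hjT hb hc' ?_ ?_ h'
  · refine List.mem_map.mpr ⟨_, hDj, ?_⟩
    have hσ : σ (X j.succ + C c') = X j.succ := by
      rw [map_add, hσX, hcvj, hσC, C_neg, add_assoc, neg_add_cancel, add_zero]
    rw [comap_ofIdealTop_span_γ_symm, RingHom.coe_coe, hσ]
  · refine List.mem_map.mpr ⟨_, hDq, ?_⟩
    have hσ : σ ((X i.succ + C b) * X j.succ + C (b * c')) = (X i.succ + C b) * X j.succ - C c' * X i.succ := by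
      simp only [map_add, map_mul, hσX, hσC, hcvj, hcvi, C_0, add_zero, C_neg]
      ring
    rw [comap_ofIdealTop_span_γ_symm, RingHom.coe_coe, hσ]

/-- **FAR RESONANCE, GLOBAL FORM.** Any `W` with an open immersion `φ : 𝔸⁵ → W` on which the centre `Zc` reads `𝓘Λ_T` and two
boundary members read `(y_j + c')·𝒪` and `((yᵢ + b) y_j + b c')·𝒪` (`i ∈ T`, `j ∉ T`, `b, c' ≠ 0`): `¬ HasSNCWith E Zc`. -/
theorem not_hasSNCWith_of_far_resonance_chart_readings {W : Scheme.{0}} [IsLocallyNoetherian W] (φ : P 4 K ⟶ W)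
    [IsOpenImmersion φ] (hiT : i ∈ T) (hjT : j ∉ T) (hb : b ≠ 0) (hc' : c' ≠ 0) {E : List W.IdealSheafData}
    {Zc Dj Dq : W.IdealSheafData} (hDjE : Dj ∈ E) (hDqE : Dq ∈ E)
    (hZc : Zc.comap φ = AffineCoordBlowup.𝓘Λ 4 K (insert 0 (Fin.succ '' (T : Set (Fin 4)))))
    (hDj : Dj.comap φ = ofIdealTop (Ideal.span {(γ 4 K).symm (X j.succ + C c')}))
    (hDq : Dq.comap φ = ofIdealTop (Ideal.span {(γ 4 K).symm ((X i.succ + C b) * X j.succ + C (b * c'))})) :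
    ¬ HasSNCWith E Zc := by
  intro h
  have h' := h.comap_of_isOpenImmersion φ
  rw [hZc] at h'
  refine not_hasSNCWith_of_far_resonance hiT hjT hb hc' ?_ ?_ h'
  · rw [← hDj]; exact List.mem_map_of_mem hDjE
  · rw [← hDq]; exact List.mem_map_of_mem hDqE

/-! ## §3 The readings of far members on the re-centred `x_j`-chart, and the obstruction on `W` -/

section Readings

variable {Θ : A 4 K ≃ₐ[K] A 4 K} {bv : Fin 4 → K}

/-- **The far member `{x_j = -c'}` (`c' ≠ 0`) reads `(y_j + b_j + c')·𝒪` on the re-centred `x_j`-chart** (`Θ yᵢ = yᵢ + bᵢ`). -/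
theorem comap_recenter_chart_strictTransform_far_self (hj : j ∈ S) (hc' : c' ≠ 0)
    (hs : ∀ k : Fin 4, Θ (X k.succ) = X k.succ + C (bv k))
    (hπ : IsBlowup π (AffineCoordBlowup.𝓘Λ 4 K (insert 0 (Fin.succ '' (S : Set (Fin 4)))))) :
    haveI : IsIso (CommRingCat.ofHom (Θ : A 4 K →+* A 4 K)) := (inferInstance : IsIso Θ.toRingEquiv.toCommRingCatIso.hom)
    (strictTransformIdeal π (AffineCoordBlowup.𝓘Λ 4 K (insert 0 (Fin.succ '' (S : Set (Fin 4)))))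
        (ofIdealTop (Ideal.span {(γ 4 K).symm (X j.succ + C c')}))).comap
        (Spec.map (CommRingCat.ofHom (Θ : A 4 K →+* A 4 K)) ≫ AffineCoordBlowup.chartImm hπ (succ_mem_centreVars hj)) =
      ofIdealTop (Ideal.span {(γ 4 K).symm (X j.succ + C (bv j + c'))}) := by
  classical
  have hC : Θ (C c') = C c' := Θ.commutes c'
  rw [Scheme.IdealSheafData.comap_comp, strictTransformIdeal_principal_comap_chartImm hj 0 (g := X j.succ + C c') ?_ ?_ hπ,
    comap_ofIdealTop_span_γ_symm, RingHom.coe_coe, map_add, hs j, hC, add_assoc, ← C_add]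
  · rw [map_add, coordBlowupSubst_X_self, coordBlowupSubst_C, pow_zero, one_mul]
  · refine not_coord_dvd_γ_symm_of_coeff 0 rfl ?_
    rw [coeff_add, coeff_zero_X, coeff_C, if_pos rfl, zero_add]
    exact hc'

/-- **A far member `{xᵢ = -cᵢ}`, `i ∈ S ∖ {j}`, `cᵢ ≠ 0`, reads the QUADRIC `((yᵢ + bᵢ)·(y_j + b_j) + cᵢ)·𝒪` on the re-centred
`x_j`-chart** (its strict transform is its total transform `xᵢ x_j + cᵢ`). -/
theorem comap_recenter_chart_strictTransform_far (hj : j ∈ S) (hi : i ∈ S) (hij : i ≠ j) {ci : K} (hci : ci ≠ 0)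
    (hs : ∀ k : Fin 4, Θ (X k.succ) = X k.succ + C (bv k))
    (hπ : IsBlowup π (AffineCoordBlowup.𝓘Λ 4 K (insert 0 (Fin.succ '' (S : Set (Fin 4)))))) :
    haveI : IsIso (CommRingCat.ofHom (Θ : A 4 K →+* A 4 K)) := (inferInstance : IsIso Θ.toRingEquiv.toCommRingCatIso.hom)
    (strictTransformIdeal π (AffineCoordBlowup.𝓘Λ 4 K (insert 0 (Fin.succ '' (S : Set (Fin 4)))))
        (ofIdealTop (Ideal.span {(γ 4 K).symm (X i.succ + C ci)}))).comap
        (Spec.map (CommRingCat.ofHom (Θ : A 4 K →+* A 4 K)) ≫ AffineCoordBlowup.chartImm hπ (succ_mem_centreVars hj)) =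
      ofIdealTop (Ideal.span {(γ 4 K).symm ((X i.succ + C (bv i)) * (X j.succ + C (bv j)) + C ci)}) := by
  classical
  have hC : Θ (C ci) = C ci := Θ.commutes ci
  rw [Scheme.IdealSheafData.comap_comp,
    strictTransformIdeal_principal_comap_chartImm hj 0 (g := X i.succ * X j.succ + C ci) ?_ ?_ hπ,
    comap_ofIdealTop_span_γ_symm, RingHom.coe_coe, map_add, map_mul, hs i, hs j, hC]
  · rw [map_add, coordBlowupSubst_C,
      coordBlowupSubst_X_of_mem_of_ne K _ j.succ (succ_mem_centreVars hi) (fun e => hij (Fin.succ_inj.mp e)),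
      pow_zero, one_mul, mul_comm]
  · refine not_coord_dvd_γ_symm_of_coeff 0 rfl ?_
    rw [coeff_add, coeff_C, if_pos rfl, coeff_X_mul', if_neg (by simp), zero_add]
    exact hci

end Readings

variable {Θⱼ : A 4 K ≃ₐ[K] A 4 K} {bv : Fin 4 → K}

/-- **FAR RESONANCE ON THE BLOWN-UP SCHEME.** `π : W → 𝔸⁵` any blowing up along `V(z, x_S)`; `Θⱼ` a re-centring of the
`x_j`-chart (`Θⱼ yᵢ = yᵢ + bᵢ`, `b_j = 0`); `Zc` the global centre of the ESCAPING next centre `V(z, x_{S'})` (`j ∉ S'`); `E` a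
boundary on `W` containing the strict transforms of two FAR old members `{x_j = -c'}` and `{xᵢ = -cᵢ}` with `i ∈ S ∩ S'`, `bᵢ ≠ 0`,
`c' ≠ 0` and RESONANT constants `cᵢ = bᵢ·c'`. Then `¬ HasSNCWith E Zc`: the escaping global centre is NOT an admissible centre for
`(W, ·, E, ·)`, although every near bad set `B` may be empty. -/
theorem not_hasSNCWith_globalCentre_of_far_resonance (hj : j ∈ S) (hi : i ∈ S) (hiS' : i ∈ S') (hjS' : j ∉ S')
    (hbj : bv j = 0) (hbi : bv i ≠ 0) (hc' : c' ≠ 0) (hs : ∀ k : Fin 4, Θⱼ (X k.succ) = X k.succ + C (bv k))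
    (hπ : IsBlowup π (AffineCoordBlowup.𝓘Λ 4 K (insert 0 (Fin.succ '' (S : Set (Fin 4)))))) {E : List W.IdealSheafData}
    (hDj : strictTransformIdeal π (AffineCoordBlowup.𝓘Λ 4 K (insert 0 (Fin.succ '' (S : Set (Fin 4)))))
      (ofIdealTop (Ideal.span {(γ 4 K).symm (X j.succ + C c')})) ∈ E)
    (hDi : strictTransformIdeal π (AffineCoordBlowup.𝓘Λ 4 K (insert 0 (Fin.succ '' (S : Set (Fin 4)))))
      (ofIdealTop (Ideal.span {(γ 4 K).symm (X i.succ + C (bv i * c'))})) ∈ E) :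
    haveI : IsIso (CommRingCat.ofHom (Θⱼ : A 4 K →+* A 4 K)) := (inferInstance : IsIso Θⱼ.toRingEquiv.toCommRingCatIso.hom)
    ¬ HasSNCWith E (vanishingIdeal (closureImage
        (Spec.map (CommRingCat.ofHom (Θⱼ : A 4 K →+* A 4 K)) ≫ AffineCoordBlowup.chartImm hπ (succ_mem_centreVars hj))
        ((AffineCoordBlowup.𝓘Λ 4 K (insert 0 (Fin.succ '' (S' : Set (Fin 4))))).support : Set (P 4 K)))) := by
  haveI hiso : IsIso (CommRingCat.ofHom (Θⱼ : A 4 K →+* A 4 K)) :=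
    (inferInstance : IsIso Θⱼ.toRingEquiv.toCommRingCatIso.hom)
  haveI : IsProper π := hπ.isProper
  haveI : IsLocallyNoetherian W := LocallyOfFiniteType.isLocallyNoetherian π
  have hij : i ≠ j := fun e => hjS' (e ▸ hiS')
  have hmul : bv i * c' ≠ 0 := mul_ne_zero hbi hc'
  refine not_hasSNCWith_of_far_resonance_chart_readings
    (Spec.map (CommRingCat.ofHom (Θⱼ : A 4 K →+* A 4 K)) ≫ AffineCoordBlowup.chartImm hπ (succ_mem_centreVars hj))
    hiS' hjS' hbi hc' hDj hDi (comap_globalCentre _ _) ?_ ?_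
  · rw [comap_recenter_chart_strictTransform_far_self hj hc' hs hπ, hbj, zero_add]
  · rw [comap_recenter_chart_strictTransform_far hj hi hij hmul hs hπ, hbj, C_0, add_zero]

end ChartDictionary

end Summit.ResolutionOfSingularities.ResolutionOfSingularities.Theorems.PIDim4

end
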